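import Summits.AnomalousDissipation.AnomalousDissipation.Theorems.SolenoidalFractalHomogenisationLagrangianStepFrameConjugatePropagator
import HarnessLib

/-!
# K1L_D (stmt-AnomalousDissipation-27980), `stub_Z7_alphaBeta` α-provider: the conjugate propagator along the CLAMPED frame curve
# (memo L16; helper; `--supports … --as helper`; lead-k1l-onelevel-p1 g5)

`FrameConj.isDistortedPropagator_conjProp` (p698495) reads the Eulerian propagator through the flow at the UNCLAMPED cell times
`σ ↦ s + σ/a`, so its distortion curve `τ ↦ frameG E m (s + τ/a) s` leaves the piece `[s, t]` for `τ ∉ [0, a(t−s)]`; since the distorted weak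
class constrains its tests at EVERY real time (`∀ τ, ∇·(G τ · Ψ τ) = 0`), the transfer hypothesis (T1) along the unclamped curve would need the
Piola structure of the flow at all times (before the reset `s`, i.e. on earlier windows and backwards flows) — memo L16.  Here the SAME
construction is run along the CLAMPED curve `τ ↦ frameG E m (s + clamp(τ)/a) s`, `clamp τ = max 0 (min τ (a(t−s)))`, with the clamped
conjugate family `(σ₁, σ₂) ↦ conjProp E hR m s U (clamp σ₁) (clamp σ₂)`: every field of `IsDistortedPropagator` only evaluates inside
`[0, a(t−s)]` (where the clamp is the identity) except `norm_le` / `divFree` / `eq_zero_of_orth`, which hold at the clamped arguments verbatim,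
and `repr`, whose transfer hypothesis **`hT1`** is now the CLAMPED one: distorted weak solutions along `τ ↦ frameG E m (s + clamp(σ₁+τ)/a) s`
— all flow times stay in the closed piece `[s, t] ⊆ [jR, (j+1)R]` (closed-window frame facts, `…ClosedWindow`).  `FrameConjugacyAt` lets the
curve `G` be anything with `IsModulation` on `[0, a(t−s)]`, which is clamp-invariant (`…FrameConjugacyAssembly` v2, this seat).
NOT a proof of the stub, of the crux, or of AD; rung F-D1.A0.
-/

set_option linter.dupNamespace false  -- the summit-side namespace `Summit.AnomalousDissipation.AnomalousDissipation.…` repeats a component by design (D-0017)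

noncomputable section

namespace Summit.AnomalousDissipation.AnomalousDissipation.Theorems.SolenoidalFractalHomogenisation.LagrangianStep.FrameConj

open Literature.Analysis Literature.Analysis.FluidPDE Literature.Analysis.FunctionSpaces
open MeasureTheory Set Filter Topology
open scoped InnerProductSpace ENNReal
open Literature.Analysis.FluidPDE.LatticeShear (LagrangianLatticeCarrier LatticeWord)
open Summit.AnomalousDissipation.AnomalousDissipation.Theorems.SolenoidalFractalHomogenisation.LagrangianStep.CellClauseMod

variable {k : ℕ}

/-- **(T2)/(T3), operator part, CLAMPED curve.**  As `isDistortedPropagator_conjProp` with the distortion curve and the conjugate family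
read at the clamped cell times `max 0 (min σ (a(t−s)))`; the transfer hypothesis `hT1` is along the clamped curve. -/
theorem isDistortedPropagator_conjProp_clamped (E : LagrangianLatticeCarrier k) (hR : E.LevelRegular) (m : ℕ) {s t : ℝ}
    (hs0 : 0 ≤ s) (hst : s < t) (ht1 : t ≤ 1)
    {B bc : ℝ → VF} {𝔸E 𝔸c : Torus.Visc4 (Fin 3)} {U : ℝ → ℝ → (V2 →L[ℝ] V2)} (hU : Torus.IsPropagator 1 B 𝔸E U)
    (hL1 : ∀ (σ : ℝ) (u : V2),
      Torus.IsWeaklyDivFree (Torus.distort (frameG E m (s + σ / E.a (m + 1)) s) (⇑(frameRead E hR m s σ u) : VF)) ↔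
        Torus.IsWeaklyDivFree (⇑u : VF))
    (hT1 : ∀ σ₁ : ℝ, 0 ≤ σ₁ → σ₁ < E.a (m + 1) * (t - s) → ∀ (φ : VF), MemLp φ 2 volume →
      Torus.IsWeaklyDivFree (Torus.distort (frameG E m (s + σ₁ / E.a (m + 1)) s) φ) → ∀ w : ℝ → VF,
      Torus.IsWeakTensorPassiveVectorDistortedOn 0 (E.a (m + 1) * (t - s) - σ₁) 𝔸c (fun τ => bc (σ₁ + τ))
        (fun τ y => frameG E m (s + max 0 (min (σ₁ + τ) (E.a (m + 1) * (t - s))) / E.a (m + 1)) s y) φ w →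
      Torus.IsWeakTensorPassiveVectorOn 0 (t - s - σ₁ / E.a (m + 1)) 𝔸E (fun τ' => B (s + σ₁ / E.a (m + 1) + τ'))
        (φ ∘ E.X m s (s + σ₁ / E.a (m + 1)))
        (fun τ' x => w (E.a (m + 1) * τ') (E.X m s (s + σ₁ / E.a (m + 1) + τ') x)))
    (hErepr : ∀ t₁ : ℝ, s ≤ t₁ → t₁ < t → ∀ (φE : VF) (hφE : MemLp φE 2 volume), Torus.IsWeaklyDivFree φE → ∀ u : ℝ → VF,
      Torus.IsWeakTensorPassiveVectorOn 0 (t - t₁) 𝔸E (fun τ' => B (t₁ + τ')) φE u →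
      ∀ᵐ τ' ∂(volume.restrict (Ioo 0 (t - t₁))), ∃ hτ : MemLp (u τ') 2 volume, hτ.toLp (u τ') = U t₁ (t₁ + τ') (hφE.toLp φE)) :
    IsDistortedPropagator (E.a (m + 1) * (t - s)) 𝔸c bc
      (fun τ y => frameG E m (s + max 0 (min τ (E.a (m + 1) * (t - s))) / E.a (m + 1)) s y)
      (fun σ₁ σ₂ => conjProp E hR m s U (max 0 (min σ₁ (E.a (m + 1) * (t - s)))) (max 0 (min σ₂ (E.a (m + 1) * (t - s))))) := by
  have ha : 0 < E.a (m + 1) := E.a_pos (m + 1)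
  have hTw : 0 < E.a (m + 1) * (t - s) := mul_pos ha (by linarith)
  -- cell time ↦ physical time
  have hmono : ∀ {σ₁ σ₂ : ℝ}, σ₁ ≤ σ₂ → s + σ₁ / (E.a (m + 1)) ≤ s + σ₂ / (E.a (m + 1)) := fun h => by
    have := div_le_div_of_nonneg_right h ha.le; linarith
  have hs_le : ∀ {σ : ℝ}, 0 ≤ σ → s ≤ s + σ / (E.a (m + 1)) := fun h => by have := div_nonneg h ha.le; linarith
  have h_le_t : ∀ {σ : ℝ}, σ ≤ (E.a (m + 1) * (t - s)) → s + σ / (E.a (m + 1)) ≤ t := fun {σ} h => by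
    have h1 : σ / (E.a (m + 1)) ≤ (E.a (m + 1) * (t - s)) / (E.a (m + 1)) := div_le_div_of_nonneg_right h ha.le
    have h2 : (E.a (m + 1) * (t - s)) / (E.a (m + 1)) = t - s := by field_simp
    linarith
  -- the clamp `σ ↦ max 0 (min σ Tw)` is the identity on `[0, Tw]`
  have hcl : ∀ {σ : ℝ}, 0 ≤ σ → σ ≤ E.a (m + 1) * (t - s) → max 0 (min σ (E.a (m + 1) * (t - s))) = σ :=
    fun h0 hT => by rw [min_eq_left hT, max_eq_right h0]
  refine ⟨?_, ?_, ?_, ?_, ?_, ?_, ?_⟩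
  · -- norm_le
    intro σ₁ σ₂ y
    unfold conjProp
    rw [ContinuousLinearMap.comp_apply, ContinuousLinearMap.comp_apply, norm_frameRead]
    refine (hU.norm_le _ _ _).trans (le_of_eq ?_)
    exact (Lp.compMeasurePreservingₗᵢ ℝ (E.X m s (s + max 0 (min σ₁ (E.a (m + 1) * (t - s))) / E.a (m + 1)))
      (hR.measurePreserving_X m s (s + max 0 (min σ₁ (E.a (m + 1) * (t - s))) / E.a (m + 1)))).norm_map y
  · -- comp
    intro σ₁ σ₂ σ₃ h1 h12 h23 h3 y
    rw [hcl h1 (h12.trans (h23.trans h3)), hcl (h1.trans h12) (h23.trans h3), hcl ((h1.trans h12).trans h23) h3]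
    unfold conjProp
    simp only [ContinuousLinearMap.comp_apply]
    rw [frameReadInv_frameRead]
    congr 1
    exact hU.comp _ _ _ (hs0.trans (hs_le h1)) (hmono h12) (hmono h23) ((h_le_t h3).trans ht1) _
  · -- self_of_divFree
    intro σ hσ0 hσT y hy
    rw [hcl hσ0 hσT] at hy ⊢
    unfold conjProp
    simp only [ContinuousLinearMap.comp_apply]
    set u : V2 := frameReadInv E hR m s σ y with hu
    have hRu : frameRead E hR m s σ u = y := by rw [hu, frameRead_frameReadInv]
    have hudiv : Torus.IsWeaklyDivFree (⇑u : VF) := by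
      rw [← hL1 σ u, hRu]; exact hy
    rw [hU.self_of_divFree _ (hs0.trans (hs_le hσ0)) ((h_le_t hσT).trans ht1) u hudiv, hRu]
  · -- divFree
    intro σ₁ σ₂ y
    unfold conjProp
    simp only [ContinuousLinearMap.comp_apply]
    exact (hL1 _ _).2 (hU.divFree _ _ _)
  · -- eq_zero_of_orth
    intro σ₁ σ₂ y hy
    set σ₁' : ℝ := max 0 (min σ₁ (E.a (m + 1) * (t - s))) with hσ₁'
    set σ₂' : ℝ := max 0 (min σ₂ (E.a (m + 1) * (t - s))) with hσ₂'
    unfold conjProp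
    simp only [ContinuousLinearMap.comp_apply]
    have h0 : U (s + σ₁' / E.a (m + 1)) (s + σ₂' / E.a (m + 1)) (frameReadInv E hR m s σ₁' y) = 0 := by
      refine hU.eq_zero_of_orth _ _ _ fun w hw => ?_
      have e : ⟪frameReadInv E hR m s σ₁' y, w⟫_ℝ = ⟪y, frameRead E hR m s σ₁' w⟫_ℝ := by
        conv_lhs => rw [← inner_frameRead E hR m s σ₁', frameRead_frameReadInv]
      rw [e]
      exact hy _ ((hL1 σ₁' w).2 hw)
    rw [h0, map_zero]
  · -- continuousOn (weak continuity: weakly continuous `U` against strongly continuous readings); the clamps are identities on `Icc σ₁ Tw`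
    intro σ₁ hσ₁0 hσ₁T y z
    refine ContinuousOn.congr (f := fun σ => ⟪conjProp E hR m s U σ₁ σ y, z⟫_ℝ) ?_ (fun σ hσ => by
      dsimp only
      rw [hcl hσ₁0 hσ₁T, hcl (hσ₁0.trans hσ.1) hσ.2])
    set t₁ : ℝ := s + σ₁ / E.a (m + 1) with ht₁
    set w : V2 := frameReadInv E hR m s σ₁ y with hw
    have ht₁0 : 0 ≤ t₁ := hs0.trans (hs_le hσ₁0)
    have ht₁1 : t₁ ≤ 1 := (h_le_t hσ₁T).trans ht1
    -- rewrite the pairing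
    have hform : ∀ σ, ⟪conjProp E hR m s U σ₁ σ y, z⟫_ℝ
        = ⟪U t₁ (s + σ / E.a (m + 1)) w, frameReadInv E hR m s σ z⟫_ℝ := by
      intro σ
      unfold conjProp
      simp only [ContinuousLinearMap.comp_apply]
      rw [← ContinuousLinearMap.adjoint_inner_right, adjoint_frameRead_eq]
    simp_rw [hform]
    -- continuity within `Icc σ₁ (E.a (m + 1) * (t - s))` at every point
    intro σ₀ hσ₀
    set B₀ : V2 := frameReadInv E hR m s σ₀ z with hB₀
    have hsplit : ∀ σ, ⟪U t₁ (s + σ / E.a (m + 1)) w, frameReadInv E hR m s σ z⟫_ℝ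
        = ⟪U t₁ (s + σ / E.a (m + 1)) w, B₀⟫_ℝ + ⟪U t₁ (s + σ / E.a (m + 1)) w, frameReadInv E hR m s σ z - B₀⟫_ℝ := by
      intro σ; rw [← inner_add_right, add_sub_cancel]
    simp_rw [hsplit]
    refine ContinuousWithinAt.add ?_ ?_
    · -- weak continuity of `U` against the fixed vector `B₀`, through the affine time change
      have hUc := hU.continuousOn t₁ ht₁0 ht₁1 w B₀
      have haff : ContinuousWithinAt (fun σ : ℝ => s + σ / E.a (m + 1)) (Icc σ₁ (E.a (m + 1) * (t - s))) σ₀ := by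
        exact (by fun_prop : Continuous fun σ : ℝ => s + σ / E.a (m + 1)).continuousWithinAt
      have hmaps : MapsTo (fun σ : ℝ => s + σ / E.a (m + 1)) (Icc σ₁ (E.a (m + 1) * (t - s))) (Icc t₁ 1) :=
        fun σ hσ => ⟨hmono hσ.1, (h_le_t hσ.2).trans ht1⟩
      have hc := ContinuousWithinAt.comp (f := fun σ : ℝ => s + σ / E.a (m + 1))
        (g := fun t' : ℝ => ⟪U t₁ t' w, B₀⟫_ℝ) (hUc _ (hmaps hσ₀)) haff hmaps
      exact hc
    · -- the remainder tends to `0`: bounded × strongly continuous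
      rw [ContinuousWithinAt, hB₀, sub_self, inner_zero_right]
      refine squeeze_zero_norm (a := fun σ => ‖w‖ * ‖frameReadInv E hR m s σ z - frameReadInv E hR m s σ₀ z‖) (fun σ => ?_) ?_
      · calc ‖⟪U t₁ (s + σ / E.a (m + 1)) w, frameReadInv E hR m s σ z - frameReadInv E hR m s σ₀ z⟫_ℝ‖
            ≤ ‖U t₁ (s + σ / E.a (m + 1)) w‖ * ‖frameReadInv E hR m s σ z - frameReadInv E hR m s σ₀ z‖ := norm_inner_le_norm _ _
          _ ≤ ‖w‖ * ‖frameReadInv E hR m s σ z - frameReadInv E hR m s σ₀ z‖ :=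
              mul_le_mul_of_nonneg_right (hU.norm_le _ _ _) (norm_nonneg _)
      · have hc : Tendsto (fun σ => frameReadInv E hR m s σ z) (𝓝[Icc σ₁ (E.a (m + 1) * (t - s))] σ₀) (𝓝 (frameReadInv E hR m s σ₀ z)) :=
          ((continuous_frameReadInv_apply E hR m s z).tendsto σ₀).mono_left nhdsWithin_le_nhds
        have h0 : Tendsto (fun σ => ‖frameReadInv E hR m s σ z - frameReadInv E hR m s σ₀ z‖) (𝓝[Icc σ₁ (E.a (m + 1) * (t - s))] σ₀) (𝓝 0) := by
          rw [← tendsto_iff_norm_sub_tendsto_zero] at *; exact hc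
        simpa using h0.const_mul ‖w‖
  · -- repr: (T1, clamped) + (E-repr)
    intro σ₁ hσ₁0 hσ₁T φ hφ hφdiv w hw
    rw [hcl hσ₁0 hσ₁T.le] at hφdiv
    set t₁ : ℝ := s + σ₁ / E.a (m + 1) with ht₁
    have ht₁s : s ≤ t₁ := hs_le hσ₁0
    have ht₁t : t₁ < t := by
      have h1 : σ₁ / (E.a (m + 1)) < (E.a (m + 1) * (t - s)) / (E.a (m + 1)) := div_lt_div_of_pos_right hσ₁T ha
      have h2 : (E.a (m + 1) * (t - s)) / (E.a (m + 1)) = t - s := by field_simp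
      rw [ht₁]; linarith
    -- the Eulerian solution from the frame solution
    have hu := hT1 σ₁ hσ₁0 hσ₁T φ hφ hφdiv w hw
    have hTT : t - s - σ₁ / E.a (m + 1) = t - t₁ := by rw [ht₁]; ring
    rw [hTT] at hu
    -- the Eulerian datum and its reading
    set φE : VF := φ ∘ E.X m s (s + σ₁ / E.a (m + 1)) with hφE
    have hφE2 : MemLp φE 2 volume := hφ.comp_measurePreserving (hR.measurePreserving_X m s _)
    have hXX : ∀ y, E.X m s (s + σ₁ / E.a (m + 1)) (E.X m (s + σ₁ / E.a (m + 1)) s y) = y := fun y => by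
      have h := congrFun (hR.X_comp_X m s (s + σ₁ / E.a (m + 1)) s) y
      rw [Function.comp_apply, hR.X_self m s] at h
      exact h
    have hRinvφ : frameReadInv E hR m s σ₁ (hφ.toLp φ) = hφE2.toLp φE := by
      refine Lp.ext ((frameReadInv_coeFn E hR m s σ₁ (hφ.toLp φ)).trans ?_)
      have h2 : (fun y => (⇑(hφ.toLp φ) : VF) (E.X m s (s + σ₁ / E.a (m + 1)) y)) =ᵐ[volume]
          fun y => φ (E.X m s (s + σ₁ / E.a (m + 1)) y) :=
        (hR.measurePreserving_X m s _).quasiMeasurePreserving.ae_eq_comp (MemLp.coeFn_toLp hφ)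
      exact h2.trans (MemLp.coeFn_toLp hφE2).symm
    have hφEdiv : Torus.IsWeaklyDivFree φE := by
      -- `frameRead σ₁ (toLp φE) = toLp φ`, whose distorted representative is div-free
      have hRφ : frameRead E hR m s σ₁ (hφE2.toLp φE) = hφ.toLp φ := by
        rw [← hRinvφ, frameRead_frameReadInv]
      have hdiv' : Torus.IsWeaklyDivFree
          (Torus.distort (frameG E m (s + σ₁ / E.a (m + 1)) s) (⇑(frameRead E hR m s σ₁ (hφE2.toLp φE)) : VF)) := by
        rw [hRφ]
        refine hφdiv.congr_ae ?_
        filter_upwards [MemLp.coeFn_toLp hφ] with y hy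
        simp only [Torus.distort, hy, ht₁]
      have h := (hL1 σ₁ (hφE2.toLp φE)).1 hdiv'
      exact h.congr_ae (MemLp.coeFn_toLp hφE2)
    -- Eulerian representation on the sub-window, read at cell times `τ = (E.a (m + 1)) τ'`
    have hrep := hErepr t₁ ht₁s ht₁t φE hφE2 hφEdiv _ hu
    have ha' : 0 < 1 / (E.a (m + 1)) := one_div_pos.2 ha
    have hrep' := Literature.Analysis.FluidPDE.Torus.ae_Ioo_comp_mul ha' hrep
    have hlen : (t - t₁) / (1 / (E.a (m + 1))) = (E.a (m + 1)) * (t - s) - σ₁ := by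
      rw [ht₁]; field_simp; ring
    rw [hlen] at hrep'
    filter_upwards [hrep', ae_restrict_mem measurableSet_Ioo] with τ hτ hτI
    rw [hcl hσ₁0 hσ₁T.le, hcl (by linarith [hτI.1]) (by linarith [hτI.2])]
    obtain ⟨hm, he⟩ := hτ
    have hta : (E.a (m + 1)) * (1 / (E.a (m + 1)) * τ) = τ := by field_simp
    have htt : t₁ + 1 / (E.a (m + 1)) * τ = s + (σ₁ + τ) / (E.a (m + 1)) := by rw [ht₁]; ring
    -- the Eulerian state at `t₁ + τ/(E.a (m + 1))` has the representative `x ↦ w τ (X m s (t₁ + τ/(E.a (m + 1))) x)`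
    have h1 := MemLp.coeFn_toLp hm
    rw [he] at h1
    have hV : (⇑(U t₁ (s + (σ₁ + τ) / (E.a (m + 1))) (hφE2.toLp φE)) : VF) =ᵐ[volume] fun x => w τ (E.X m s (s + (σ₁ + τ) / (E.a (m + 1))) x) := by
      rw [← htt]
      refine h1.trans (Filter.Eventually.of_forall fun x => ?_)
      simp only [hta, ht₁]
    -- `conjProp U σ₁ (σ₁+τ) (toLp φ) = frameRead (σ₁+τ) (U t₁ (s+(σ₁+τ)/(E.a (m + 1))) (toLp φE))`
    have hconj : conjProp E hR m s U σ₁ (σ₁ + τ) (hφ.toLp φ)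
        = frameRead E hR m s (σ₁ + τ) (U t₁ (s + (σ₁ + τ) / (E.a (m + 1))) (hφE2.toLp φE)) := by
      unfold conjProp
      simp only [ContinuousLinearMap.comp_apply]
      rw [hRinvφ]
    -- reading back gives `w τ` (E.a (m + 1)).e.
    have hread : (⇑(frameRead E hR m s (σ₁ + τ) (U t₁ (s + (σ₁ + τ) / (E.a (m + 1))) (hφE2.toLp φE))) : VF) =ᵐ[volume] w τ := by
      have h2 := frameRead_coeFn E hR m s (σ₁ + τ) (U t₁ (s + (σ₁ + τ) / (E.a (m + 1))) (hφE2.toLp φE))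
      have h3 : (fun y => (⇑(U t₁ (s + (σ₁ + τ) / (E.a (m + 1))) (hφE2.toLp φE)) : VF) (E.X m (s + (σ₁ + τ) / (E.a (m + 1))) s y)) =ᵐ[volume]
          fun y => (fun x => w τ (E.X m s (s + (σ₁ + τ) / (E.a (m + 1))) x)) (E.X m (s + (σ₁ + τ) / (E.a (m + 1))) s y) :=
        (hR.measurePreserving_X m _ s).quasiMeasurePreserving.ae_eq_comp hV
      refine (h2.trans h3).trans (Filter.Eventually.of_forall fun y => ?_)
      have hXX' : E.X m s (s + (σ₁ + τ) / (E.a (m + 1))) (E.X m (s + (σ₁ + τ) / (E.a (m + 1))) s y) = y := by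
        have h := congrFun (hR.X_comp_X m s (s + (σ₁ + τ) / (E.a (m + 1))) s) y
        rw [Function.comp_apply, hR.X_self m s] at h
        exact h
      simp only [hXX']
    have hwτ : MemLp (w τ) 2 volume := (Lp.memLp _).ae_eq hread
    refine ⟨hwτ, ?_⟩
    rw [hconj]
    exact Lp.ext ((MemLp.coeFn_toLp hwτ).trans hread.symm)

end Summit.AnomalousDissipation.AnomalousDissipation.Theorems.SolenoidalFractalHomogenisation.LagrangianStep.FrameConj

end
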